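/-
COR-CM (cell pub-hodgecm2, stage 2 of the Hodge ladder) — TRANSPOSITION SURGE, DICTIONARY ITEM (ii) of rfwf v3 §4.2:
PROOF of the displayed obligation `Transposition.Item2 U` of the interface file `Transposition/Item2Reflex.lean`
(p272885, typer prover-pub-hodgecm2-tr-typer-2-0) for EVERY universe `U`, following the typer's PROVER-BRIEF P1
(`run/shared/lean/pub/pub-hodgecm2/transposition/item-2/PROVER-BRIEF.md`).
Author: prover-pub-hodgecm2-b01-g55-0 (b01 gen 55), acting for the unseated `pub-hodgecm2-tr-prover-2` slot
(HOME/INBOX CLAIM ITEM2-HOLDS 2026-08-21T12:58:26Z; lead pre-ACK of the path pattern `Transposition/Item2Holds*.lean`, HOME/INBOX l.3654).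
Filed by the seated `pub-hodgecm2-tr-prover-2` (prover-pub-hodgecm2-tr-prover-2-0, seated 2026-08-21T13:11Z) per lead ruling
HOME/INBOX l.3752 (1) and the writer resolution HOME/INBOX l.3786 / l.3801: the MATHEMATICS below is b01 g55's bytes
(`HOME/pub-hodgecm2-b01/work-ITEM2-HOLDS/Item2Holds.lean`, md5 710c07051fa5, 345 l.) UNCHANGED; only this paragraph is added.
FRAMING (COORDINATOR RULING 2026-08-21T11:55:35Z, binding): `HC_CM` is NOT proved; this file proves a piece of finite Galois
bookkeeping about CM types (the inverse types exist and inherit the pair-sum identity and pairwise distinctness), nothing more.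

MATHEMATICS.  `F` a Galois CM field, `σ : F → ℂ` an embedding.  Since `F/ℚ` is normal, `g ↦ σ ∘ g` is a bijection
`Gal(F/ℚ) ≃ Hom(F, ℂ)` (`galEmb`).  The INVERSION THROUGH `σ` is the involution `κ_σ(σ ∘ g) := σ ∘ g⁻¹` of `Hom(F, ℂ)`
(`invEmb`; PerL (eq. Psit) `Ψ_t = φʰ Φ̃_t⁻¹`, rfwf l.222 `Ψ_i := φʰ Θ_i⁻¹`, base point `φʰ = 1`; the `κ` of the stage-1
sign recipe, PKG `Automorphic/ThetaModel.lean`:92).  It commutes with complex conjugation (complex conjugation of the CM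
field `F` is induced by ONE central `c ∈ Gal(F/ℚ)` under every embedding, Mathlib `IsCMField.complexEmbedding_complexConj`),
fixes `σ`, and hence preserves the fibre `{σ, σ̄}` of the place of `σ`.  The INVERSE TYPE of a CM type `Θ` through `σ` is
`κ_σ⁻¹(Θ) = {τ | κ_σ τ ∈ Θ}` (`invType`) — a CM type because `κ_σ` is conjugation-equivariant; `Θ ↦ κ_σ⁻¹(Θ)` is an
involution (so injective), indicators transform by `1_{κ⁻¹Θ}(τ) = 1_Θ(κ τ)`, so the pair-sum identity of `f.psi`
(`pairSum_psi`, CM/Lemmas.lean:72) and the injectivity of `f.psi` (`StubTree.psi_injective`, StubTree/Combinatorics.lean:37)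
transport verbatim («inverted and translated by the central φʰ», rfwf l.243).  The off-place witness: `f.psi 0 = Φ` and
`f.psi 1 = Φ^{(ππ′)}` differ at `f.p` (which lies over `π`, not over `π′`), so `τ := κ_σ(f.p)` separates the inverse
types, and `τ` is off the place of `σ` because `f.p` is (admissibility) and `κ_σ` preserves that fibre.
-/
import Summits.HodgeConjecture.CorCM.B01.Transposition.Item2Reflex
import Summits.HodgeConjecture.CorCM.StubTree.Combinatorics
import Literature.NumberTheory.ComplexMultiplication.ReflexCMType
import HarnessLib

/-!
# Transposition item (ii) holds for every universe: `Transposition.item2_holds`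

Contents (namespace `Summit.HodgeConjecture.CorCM.Transposition`):
* §1 `galEmb σ : Gal(F/ℚ) ≃ Hom(F, ℂ)`, `g ↦ σ ∘ g` (F Galois);
* §2 `invEmb σ` = `κ_σ`, the inversion through `σ` (`κ_σ(σ∘g) = σ∘g⁻¹`): involutive, conjugation-equivariant,
  `κ_σ σ = σ`, place-of-`σ`-preserving;
* §3 `invType σ Θ` — the inverse type `κ_σ⁻¹ Θ` as a `CMType F`; membership/indicator lemmas, involutivity, injectivity,
  UNIQUENESS (`eq_invType_of_isInverse`: the `isInverse` relation determines the type), transport of `PairSum`;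
* §4 the face: `f.p ∈ f.psi 0 ↔ f.p ∉ f.psi 1`; labels of ANY `Item2Datum` are the inverse types (`Item2Datum.Ψ_eq_invType`,
  `.Ψ_eq`, `.mem_Ψ_iff` — the bridge `τ ∈ Ψ i ↔ κ_σ τ ∈ f.psi i` to item (iv)); the datum `item2Datum`;
  **`item2_holds : Item2 U`** and its coupled / oriented unpackings.
Independent convergent bytes for P1 by prover-pub-hodgecm2-b09-g14-0 (`HOME/pub-hodgecm2-b09/Item2Holds-offer.lean`,
md5 01099f5d2490, handed over BY NAME, HOME/INBOX l.3764) are acknowledged; none are copied here.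
No `sorry`, no new axiom, no named fact; axioms `propext`, `Classical.choice`, `Quot.sound`.
-/

noncomputable section

namespace Summit.HodgeConjecture.CorCM

namespace Transposition

open Literature.AlgebraicGeometry.Motives (CMType)
open NumberField NumberField.ComplexEmbedding
open Literature.NumberTheory.ComplexMultiplication
open Literature.NumberTheory.ComplexMultiplication.CMTypeOps

/-! ### §1 `Gal(F/ℚ) ≃ Hom(F, ℂ)` through a base embedding -/

section Galois

variable {F : CMField}

/-- `σ ∘ g` evaluated. [folklore] -/
@[simp] theorem comp_algEquiv_apply (σ : F →+* ℂ) (g : F ≃ₐ[ℚ] F) (x : F) :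
    σ.comp (g : F →+* F) x = σ (g x) := rfl

/-- `g ↦ σ ∘ g` is injective on `Gal(F/ℚ)` (`σ` is injective). [folklore] -/
theorem comp_algEquiv_injective (σ : F →+* ℂ) :
    Function.Injective fun g : F ≃ₐ[ℚ] F => σ.comp (g : F →+* F) := by
  intro g h e
  apply AlgEquiv.ext
  intro x
  exact σ.injective (by simpa using RingHom.congr_fun e x)

variable [IsGalois ℚ F]

/-- For `F/ℚ` Galois every complex embedding `τ` of `F` is `σ ∘ g` for some `g ∈ Gal(F/ℚ)` (normality:
`exists_algHom_comp_eq_of_normal`, then `Hom_ℚ(F,F) = Gal(F/ℚ)` for a number field). [folklore] -/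
theorem exists_algEquiv_comp_eq (σ τ : F →+* ℂ) : ∃ g : F ≃ₐ[ℚ] F, σ.comp (g : F →+* F) = τ := by
  obtain ⟨ψ, hψ⟩ := exists_algHom_comp_eq_of_normal (AlgHom.id ℚ F) σ τ
  refine ⟨(Algebra.IsAlgebraic.algEquivEquivAlgHom ℚ F).symm ψ, ?_⟩
  rw [← hψ]
  rfl

/-- **`Gal(F/ℚ) ≃ Hom(F, ℂ)`, `g ↦ σ ∘ g`** (F Galois; rfwf §3: «identify `Hom(F, ℂ)` with `G` via `g ↦ ι₁ ∘ g`»). [folklore] -/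
def galEmb (σ : F →+* ℂ) : (F ≃ₐ[ℚ] F) ≃ (F →+* ℂ) :=
  Equiv.ofBijective (fun g : F ≃ₐ[ℚ] F => σ.comp (g : F →+* F))
    ⟨comp_algEquiv_injective σ, fun τ => exists_algEquiv_comp_eq σ τ⟩

/-- [folklore] -/
@[simp] theorem galEmb_apply (σ : F →+* ℂ) (g : F ≃ₐ[ℚ] F) : galEmb σ g = σ.comp (g : F →+* F) := rfl

/-- `σ ∘ (galEmb σ)⁻¹ τ = τ`. [folklore] -/
@[simp] theorem comp_galEmb_symm (σ τ : F →+* ℂ) : σ.comp ((galEmb σ).symm τ : F →+* F) = τ :=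
  (galEmb σ).apply_symm_apply τ

/-- `(galEmb σ)⁻¹ (σ ∘ g) = g`. [folklore] -/
@[simp] theorem galEmb_symm_comp (σ : F →+* ℂ) (g : F ≃ₐ[ℚ] F) : (galEmb σ).symm (σ.comp (g : F →+* F)) = g :=
  (galEmb σ).symm_apply_apply g

/-- `(galEmb σ)⁻¹ σ = 1`. [folklore] -/
@[simp] theorem galEmb_symm_self (σ : F →+* ℂ) : (galEmb σ).symm σ = 1 := by
  have h : σ = σ.comp ((1 : F ≃ₐ[ℚ] F) : F →+* F) := RingHom.ext fun _ => rfl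
  conv_lhs => rw [h]
  exact galEmb_symm_comp σ 1

/-! ### §2 The inversion `κ_σ` through `σ` -/

/-- **`κ_σ`**: the inversion of `Hom(F, ℂ)` through `σ`, `κ_σ(σ ∘ g) = σ ∘ g⁻¹` (PerL (eq. Psit) with base point `φʰ = 1`;
rfwf l.222; the `κ` of the stage-1 sign recipe `ThetaModel.kappa`). [folklore] -/
def invEmb (σ : F →+* ℂ) (τ : F →+* ℂ) : F →+* ℂ := σ.comp (((galEmb σ).symm τ).symm : F →+* F)

/-- `κ_σ(σ ∘ g) = σ ∘ g⁻¹`. [folklore] -/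
@[simp] theorem invEmb_comp (σ : F →+* ℂ) (g : F ≃ₐ[ℚ] F) :
    invEmb σ (σ.comp (g : F →+* F)) = σ.comp (g.symm : F →+* F) := by
  simp [invEmb]

/-- `κ_σ` is an involution. [folklore] -/
theorem invEmb_invEmb (σ τ : F →+* ℂ) : invEmb σ (invEmb σ τ) = τ := by
  obtain ⟨g, rfl⟩ := exists_algEquiv_comp_eq σ τ
  rw [invEmb_comp, invEmb_comp, AlgEquiv.symm_symm]

/-- [folklore] -/
theorem invEmb_involutive (σ : F →+* ℂ) : Function.Involutive (invEmb σ) := invEmb_invEmb σ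

/-- [folklore] -/
theorem invEmb_injective (σ : F →+* ℂ) : Function.Injective (invEmb σ) := (invEmb_involutive σ).injective

/-- `κ_σ σ = σ` (`1⁻¹ = 1`). [folklore] -/
@[simp] theorem invEmb_self (σ : F →+* ℂ) : invEmb σ σ = σ := by
  simp only [invEmb, galEmb_symm_self]
  exact RingHom.ext fun _ => rfl

/-- Complex conjugation of `F` is induced by the Galois element `c = complexConj F` under EVERY embedding: post-composing
`g` with `c` conjugates `σ ∘ g`. [folklore] -/
theorem comp_trans_conj (σ : F →+* ℂ) (g : F ≃ₐ[ℚ] F) :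
    σ.comp ((g.trans ((IsCMField.complexConj F).restrictScalars ℚ)) : F →+* F) = conjugate (σ.comp (g : F →+* F)) := by
  refine RingHom.ext fun x => ?_
  simp only [comp_algEquiv_apply, AlgEquiv.trans_apply, AlgEquiv.coe_restrictScalars,
    IsCMField.complexEmbedding_complexConj, conjugate_coe_eq]

/-- … and pre-composing conjugates as well (apply the previous fact to the embedding `σ ∘ g`). [folklore] -/
theorem comp_conj_trans (σ : F →+* ℂ) (g : F ≃ₐ[ℚ] F) :
    σ.comp (((((IsCMField.complexConj F).restrictScalars ℚ)).trans g) : F →+* F) = conjugate (σ.comp (g : F →+* F)) := by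
  refine RingHom.ext fun x => ?_
  simp only [comp_algEquiv_apply, AlgEquiv.trans_apply, AlgEquiv.coe_restrictScalars, conjugate_coe_eq]
  exact IsCMField.complexEmbedding_complexConj F (σ.comp (g : F →+* F)) x

/-- Complex conjugation of `F` is an involution: as a `ℚ`-algebra automorphism it is its own inverse. [folklore] -/
theorem conj_restrictScalars_symm_apply (x : F) :
    ((IsCMField.complexConj F).restrictScalars ℚ).symm x = IsCMField.complexConj F x := by
  rw [AlgEquiv.symm_apply_eq, AlgEquiv.coe_restrictScalars, IsCMField.complexConj_apply_apply]

/-- **`κ_σ` commutes with complex conjugation**: `κ_σ(τ̄) = conj ∘ κ_σ(τ)` (stage-1 `Design_kappaConj`; centrality of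
`c` is not even needed in this form: `(g c)⁻¹ = c⁻¹ g⁻¹ = c g⁻¹`). [folklore] -/
theorem invEmb_conjugate (σ τ : F →+* ℂ) : invEmb σ (conjugate τ) = conjugate (invEmb σ τ) := by
  obtain ⟨g, rfl⟩ := exists_algEquiv_comp_eq σ τ
  rw [← comp_trans_conj, invEmb_comp, invEmb_comp, ← comp_conj_trans]
  refine RingHom.ext fun x => ?_
  simp only [comp_algEquiv_apply, AlgEquiv.symm_trans_apply, AlgEquiv.trans_apply, conj_restrictScalars_symm_apply,
    AlgEquiv.coe_restrictScalars]

/-- `κ_σ` preserves the fibre `{σ, σ̄}` of the place of `σ`: `κ_σ τ` lies over the place of `σ` iff `τ` does. [folklore] -/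
theorem mk_invEmb_eq_iff (σ τ : F →+* ℂ) :
    InfinitePlace.mk (invEmb σ τ) = InfinitePlace.mk σ ↔ InfinitePlace.mk τ = InfinitePlace.mk σ := by
  have key : ∀ ρ : F →+* ℂ, InfinitePlace.mk ρ = InfinitePlace.mk σ ↔ ρ = σ ∨ ρ = conjugate σ := by
    intro ρ
    rw [InfinitePlace.mk_eq_iff]
    constructor
    · rintro (h | h)
      · exact Or.inl h
      · exact Or.inr (by rw [← h, (involutive_conjugate F) ρ])
    · rintro (h | h)
      · exact Or.inl h
      · exact Or.inr (by rw [h, (involutive_conjugate F) σ])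
  rw [key, key]
  have h1 : invEmb σ τ = σ ↔ τ = σ := by
    constructor
    · intro h
      exact invEmb_injective σ (by rw [h, invEmb_self])
    · intro h
      rw [h, invEmb_self]
  have h2 : invEmb σ τ = conjugate σ ↔ τ = conjugate σ := by
    constructor
    · intro h
      exact invEmb_injective σ (by rw [h, invEmb_conjugate, invEmb_self])
    · intro h
      rw [h, invEmb_conjugate, invEmb_self]
  rw [h1, h2]

/-! ### §3 The inverse type through `σ` -/

/-- **The inverse type `κ_σ⁻¹ Θ = {τ | κ_σ τ ∈ Θ}` of a CM type `Θ` through `σ`** (rfwf `Ψ = Θ⁻¹` l.222, PerL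
(eq. Psit); Shimura's `S*` read back in `Hom(F, ℂ)`): a CM type because `κ_σ` commutes with conjugation. [folklore] -/
def invType (σ : F →+* ℂ) (Θ : CMType F) : CMType F :=
  ⟨{τ | invEmb σ τ ∈ Θ.1}, fun τ => by
    simp only [Set.mem_setOf_eq, invEmb_conjugate]
    exact Θ.2 _⟩

/-- [folklore] -/
theorem mem_invType_iff (σ : F →+* ℂ) (Θ : CMType F) (τ : F →+* ℂ) : τ ∈ (invType σ Θ).1 ↔ invEmb σ τ ∈ Θ.1 :=
  Iff.rfl

/-- **`σ ∘ g ∈ κ_σ⁻¹ Θ ↔ σ ∘ g⁻¹ ∈ Θ`** — the `isInverse` relation of `Item2Datum`. [folklore] -/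
theorem comp_mem_invType_iff (σ : F →+* ℂ) (Θ : CMType F) (g : F ≃ₐ[ℚ] F) :
    σ.comp (g : F →+* F) ∈ (invType σ Θ).1 ↔ σ.comp (g.symm : F →+* F) ∈ Θ.1 := by
  rw [mem_invType_iff, invEmb_comp]

/-- Indicators: `1_{κ⁻¹Θ}(τ) = 1_Θ(κ τ)`. [folklore] -/
theorem ind_invType (σ : F →+* ℂ) (Θ : CMType F) (τ : F →+* ℂ) : ind (invType σ Θ) τ = ind Θ (invEmb σ τ) := by
  by_cases h : invEmb σ τ ∈ Θ.1
  · rw [ind_of_mem h, ind_of_mem ((mem_invType_iff σ Θ τ).mpr h)]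
  · rw [ind_of_not_mem h, ind_of_not_mem (fun h' => h ((mem_invType_iff σ Θ τ).mp h'))]

/-- `Θ ↦ κ_σ⁻¹ Θ` is an involution (`(Θ⁻¹)⁻¹ = Θ`). [folklore] -/
theorem invType_invType (σ : F →+* ℂ) (Θ : CMType F) : invType σ (invType σ Θ) = Θ := by
  apply Subtype.ext
  ext τ
  change invEmb σ (invEmb σ τ) ∈ Θ.1 ↔ τ ∈ Θ.1
  rw [invEmb_invEmb]

/-- `Θ ↦ κ_σ⁻¹ Θ` is injective. [folklore] -/
theorem invType_injective (σ : F →+* ℂ) : Function.Injective (invType σ) :=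
  (show Function.Involutive (invType σ) from invType_invType σ).injective

/-- **Uniqueness of the inverse type**: a CM type `Ψ` standing in the `isInverse` relation to `Θ` (for all
`g ∈ Gal(F/ℚ)`: `σ ∘ g ∈ Ψ ↔ σ ∘ g⁻¹ ∈ Θ`) IS `κ_σ⁻¹ Θ` — every embedding is some `σ ∘ g`. [folklore] -/
theorem eq_invType_of_isInverse (σ : F →+* ℂ) {Θ Ψ : CMType F}
    (h : ∀ g : F ≃ₐ[ℚ] F, σ.comp (g : F →+* F) ∈ Ψ.1 ↔ σ.comp (g.symm : F →+* F) ∈ Θ.1) : Ψ = invType σ Θ := by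
  apply Subtype.ext
  ext τ
  obtain ⟨g, rfl⟩ := exists_algEquiv_comp_eq σ τ
  rw [comp_mem_invType_iff]
  exact h g

/-- … and symmetrically `Θ` is determined by `Ψ`: `Θ = κ_σ⁻¹ Ψ` (`(Θ⁻¹)⁻¹ = Θ`). [folklore] -/
theorem eq_invType_of_isInverse' (σ : F →+* ℂ) {Θ Ψ : CMType F}
    (h : ∀ g : F ≃ₐ[ℚ] F, σ.comp (g : F →+* F) ∈ Ψ.1 ↔ σ.comp (g.symm : F →+* F) ∈ Θ.1) : Θ = invType σ Ψ := by
  rw [eq_invType_of_isInverse σ h, invType_invType]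

/-- **(T1) transported**: the pair-sum identity passes to the inverse types (evaluate at `κ_σ τ`). [folklore] -/
theorem pairSum_invType (σ : F →+* ℂ) {Ψ : Fin 4 → CMType F} (h : PairSum Ψ) :
    PairSum fun i => invType σ (Ψ i) := by
  intro τ
  simp only [ind_invType]
  exact h (invEmb σ τ)

end Galois

/-! ### §4 The face: item (ii) holds -/

section FaceItem

variable {F : CMField}

/-- `Θ₀ = Φ` and `Θ₁ = Φ^{(ππ′)}` differ at `f.p` (which lies over `π` and not over `π′`). [folklore] -/
theorem psi_zero_psi_one_differ_at_p (f : Face F) : f.p ∈ (f.psi 0).1 ↔ f.p ∉ (f.psi 1).1 := by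
  have hp : f.p ∈ placeSet f.p := by simp [placeSet]
  have hpn : f.p ∉ placeSet f.p' := fun h => Face.not_mem_both f hp h
  change f.p ∈ f.Φ.1 ↔ f.p ∉ (flip f.p' (flip f.p f.Φ)).1
  rw [mem_flip_iff, mem_flip_iff]
  tauto

section Labels

variable {U : Universe} [IsGalois ℚ F]

/-- **The labels of ANY item-(ii) datum are the inverse types** (for `F` Galois): `D.Ψ i = κ_σ⁻¹ (f.psi i)` — the field
`isInverse` determines `Ψ`; in particular the labels do not depend on the datum, and consumers may rewrite any
`D : Item2Datum U f ι₁ V σ` to the explicit inverse types. [folklore] -/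
theorem Item2Datum.Ψ_eq_invType {f : Face F} {ι₁ : F →+* ℂ} {V : HermSpace3 F ι₁} {σ : F →+* ℂ}
    (D : Item2Datum U f ι₁ V σ) (i : Fin 4) : D.Ψ i = invType σ (f.psi i) :=
  eq_invType_of_isInverse σ (D.isInverse i)

/-- The labels of two item-(ii) data at the same face context coincide. [folklore] -/
theorem Item2Datum.Ψ_eq {f : Face F} {ι₁ : F →+* ℂ} {V : HermSpace3 F ι₁} {σ : F →+* ℂ}
    (D D' : Item2Datum U f ι₁ V σ) : D.Ψ = D'.Ψ :=
  funext fun i => (D.Ψ_eq_invType i).trans (D'.Ψ_eq_invType i).symm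

/-- Membership in the labels of any datum: `τ ∈ D.Ψ i ↔ κ_σ τ ∈ f.psi i`. [folklore] -/
theorem Item2Datum.mem_Ψ_iff {f : Face F} {ι₁ : F →+* ℂ} {V : HermSpace3 F ι₁} {σ : F →+* ℂ}
    (D : Item2Datum U f ι₁ V σ) (i : Fin 4) (τ : F →+* ℂ) : τ ∈ (D.Ψ i).1 ↔ invEmb σ τ ∈ (f.psi i).1 := by
  rw [D.Ψ_eq_invType i, mem_invType_iff]

end Labels

variable (U : Universe)

/-- **The datum of item (ii)** at a face context `(F, f, ι₁, V, σ)` with `F` Galois and `σ` off the places `π, π′` of the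
face: labels `Ψ i := κ_σ⁻¹ (f.psi i)`, (T1)/(T2) transported, off-place witness `κ_σ(f.p)`, dictionary `ofUiso`. [folklore] -/
def item2Datum [IsGalois ℚ F] (f : Face F) (ι₁ : F →+* ℂ) (V : HermSpace3 F ι₁) (σ : F →+* ℂ)
    (hσ : InfinitePlace.mk σ ≠ InfinitePlace.mk f.p) : Item2Datum U f ι₁ V σ where
  Ψ i := invType σ (f.psi i)
  isInverse i g := comp_mem_invType_iff σ (f.psi i) g
  pairSum := pairSum_invType σ (pairSum_psi f)
  injective := (invType_injective σ).comp (StubTree.psi_injective F f)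
  offPlace := by
    refine ⟨invEmb σ f.p, fun h => hσ ?_, ?_⟩
    · exact ((mk_invEmb_eq_iff σ f.p).mp h).symm
    · rw [mem_invType_iff, mem_invType_iff, invEmb_invEmb]
      exact psi_zero_psi_one_differ_at_p f
  dec := TypeDecomposition.ofUiso ι₁ V σ

/-- The labels of `item2Datum` are the inverse types. [folklore] -/
@[simp] theorem item2Datum_Ψ [IsGalois ℚ F] (f : Face F) (ι₁ : F →+* ℂ) (V : HermSpace3 F ι₁) (σ : F →+* ℂ)
    (hσ : InfinitePlace.mk σ ≠ InfinitePlace.mk f.p) (i : Fin 4) :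
    (item2Datum U f ι₁ V σ hσ).Ψ i = invType σ (f.psi i) := rfl

/-- **BRIDGE TO ITEM (iv)**: membership in the label `Ψ i` is membership of `κ_σ τ` in the target type `f.psi i`
(`τ ∈ Ψ i ↔ κ_σ τ ∈ Θ_i`): item (iv)'s forced signs `reqPos … (f.psi i) τ` for a recipe with `κ = κ_σ` ARE the signs of
the label `Ψ i` at `τ`. [folklore] -/
theorem mem_item2Datum_Ψ_iff [IsGalois ℚ F] (f : Face F) (ι₁ : F →+* ℂ) (V : HermSpace3 F ι₁) (σ : F →+* ℂ)
    (hσ : InfinitePlace.mk σ ≠ InfinitePlace.mk f.p) (i : Fin 4) (τ : F →+* ℂ) :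
    τ ∈ ((item2Datum U f ι₁ V σ hσ).Ψ i).1 ↔ invEmb σ τ ∈ (f.psi i).1 :=
  Iff.rfl

/-- **ITEM (ii) OF rfwf §4.2 HOLDS FOR EVERY UNIVERSE** (the displayed obligation `Transposition.Item2` of
`Item2Reflex.lean`, p272885): for every Galois CM field (the degree bound is not used), every rank-four face, every
admissible eigen-embedding `σ`, every surface embedding `ι₁` at the place of `σ`, every hermitian 3-space `V`, the
inverse types of the four period types through `σ` exist as CM types and inherit the pair-sum identity, pairwise
distinctness and an off-place difference; the dictionary is the tautological `TypeDecomposition.ofUiso`.  (The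
substantive MODEL-side reading of PerL Prop. 2.3 — a named `TypeDecomposition` on the universe of record — is P2 of
the typer's brief and is not claimed here.) [folklore] -/
theorem item2_holds : Item2 U := by
  intro F hG _h6 f σ hσ ι₁ _hι V
  exact ⟨item2Datum U f ι₁ V σ hσ.2.1⟩

/-- `Item2Datum` at a coupled face context `σ = ι₁`, for every universe. [folklore] -/
theorem item2Datum_nonempty {F : CMField} (hG : IsGalois ℚ F) (h6 : 6 ≤ Module.finrank ℚ F) (f : Face F)
    {ι₁ : F →+* ℂ} (hι : f.Admissible ι₁) (V : HermSpace3 F ι₁) : Nonempty (Item2Datum U f ι₁ V ι₁) :=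
  (item2_holds U).nonempty hG h6 f hι V

/-- `Item2Datum` at an oriented face context, for every universe. [folklore] -/
theorem item2Datum_nonempty_of_mk_eq {F : CMField} (hG : IsGalois ℚ F) (h6 : 6 ≤ Module.finrank ℚ F) (f : Face F)
    {σ : F →+* ℂ} (hσ : f.Admissible σ) {ι₁ : F →+* ℂ} (hι : InfinitePlace.mk ι₁ = InfinitePlace.mk σ)
    (V : HermSpace3 F ι₁) : Nonempty (Item2Datum U f ι₁ V σ) :=
  (item2_holds U).nonempty_of_mk_eq hG h6 f hσ hι V

end FaceItem

end Transposition

end Summit.HodgeConjecture.CorCM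

end
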